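/-
Copyright (c) 2026 the pub-hodgecm-mathlib formalisation cell (harness21).  Prover seat hodgecm-mathlib-LH4-p10 (g6): Track A «(D-RAM) FOUR-FRAME» squad of crux H413, STAGE-1b,
(β-BAL) road — dealer LH4-plan (g13) WORD #82 (B) «B2a-2», LH4-p11 (g8) SIG `SIG-B2a2-labelledOddFibre.v1` dbcde430.  2026-09-04.
-/
import Summits.HodgeConjecture.HodgeConjecture.Theorems.F0P3cDyRamDiagonalLabelledOddFibreStep   -- FILE 1∕3 (this seat): Step 1, the letters `s(e,u)`, `pol(e,u)`, the labelled fibre; brings the DEFS leaf (LH4-p11) and ★ (Oκ2b)'s imports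
import Mathlib.Tactic.FieldSimp
import Mathlib.Tactic.LinearCombination
import HarnessLib

/-!
# Crux `H413`, line LH4 «(D-RAM) FOUR-FRAME» — (β-BAL) road, brick B2a-2 FILE 2∕3: THE POLARISATION CLASSES MODULO `N(S̃)` SEEN FROM THE ORBIT (which `(e, u)` give which class, the signed label of a class)

Cell `hodgecm-mathlib` (D-0151), FLOOR 0, crux item H413 = `stmt-HodgeConjecture-24833`, route `HCCMUnconditional`; squad F0∕P3c∕LH4.  THEOREMS ONLY; lane
`--supports stmt-HodgeConjecture-24833 --as helper` (count-neutral).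

WHAT.  The twin of ★ (Oκ2b) `F0P3cDyRamDiagonalKappaOrbitFibreCount.sum_signChar_mul_finsum_ncard_fibre_mul_relIndex_eq` with a TORUS-EQUIVARIANT LABEL `Λ` on (lattice, form)
pairs (`Λ(diag(z)M, D) ↔ Λ(M, D·N(z))`, LH4-p11 (g8)'s DEFS `IsTorusEquivariantLabel`): along the unit-torus orbit of `M₀`,
`(Σ_e (−1)^{e_i} · Σᶠ_{M ∈ 𝒯·M₀} #{a : diag(ϖu^a)M is a type-tv vertex of diag(d_e) ∧ Λ(diag(ϖu^a)M, d_e)}) · [𝒰 : N(S̃(M₀) ∩ 𝒯)] = 8 · [𝒯 : S̃(M₀) ∩ 𝒯] · labelledOddCount σ ϖ tv i Λ M₀`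
— statement = LH4-p11 (g8) SIG (B2a-2) v1 §1 TOKEN FOR TOKEN.
PROOF.  ★ (O2b) Steps 1–4 with the label riding along (by `hΛ` at `z = ϖu^a·u` the labelled fibre over `diag(u)M₀` is `{a₀}` iff `s(e,u) := d_e·N(u)·w⁻¹ ∈ S_F(M₀)` AND
`Λ M₀ (D₁·s(e,u))`, a condition constant on the `S̃`-coset of `u`); then, with `H := 𝒯 ⊓ N⁻¹(S_F)`, `H₀ := 𝒯 ⊓ N⁻¹(N S̃)` (`S̃ ≤ H₀ ≤ H`): for a good `e` the labelled orbit set is a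
disjoint union over the `H₀`-cosets `h̄` of `H` with `Λ M₀ (D₁·s₀(e)·N h)` of translates of the `H₀`-orbit, each of size `[H₀ : S̃]`; the pairs `(e good, h̄)` are in bijection with
`polarisationNormClasses σ ϖ tv M₀` (classes `D·N(S̃)`), on which the sign is `ω(D_i) = (−1)^{e_i}` (norms are `ω`-trivial) and `Λ` is constant — so the signed labelled count
is `[H₀ : S̃] · labelledOddCount`; finally `[H₀ : S̃]·[𝒰 : N S̃] = 8·[𝒯 : S̃]` (`N : 𝒯∕H₀ ≅ N𝒯∕N S̃`, ★ `h8`).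
HONEST LABEL.  Count-neutral; pays no tier-0 row (the eightfold vanishing ∕ (β-BAL) ∕ `stub_law_cleanSgn` stay OPEN until LH4-p11's B2a-3 and LH4-p05's END land); `HC_CM`
is proved only modulo the 7 printed citations (2 remaining named inputs: hLiu418 = `stmt-HodgeConjecture-24832`, h413 = `stmt-HodgeConjecture-24833`) until rung 0 closes.

## References
* [Kottwitz1986BaseChangeUnits] R. E. Kottwitz, *Base change for unit elements of Hecke algebras*, Compositio Math. 60 (1986), §1 pp. 240–241.
* [Rogawski1990] J. D. Rogawski, *Automorphic Representations of Unitary Groups in Three Variables*, Ann. of Math. Stud. 123 (1990), §4.9 Prop. 4.9.1 (a)(b) p. 55, §4.10 p. 58.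
* [LanglandsShelstad1987] R. P. Langlands, D. Shelstad, *On the definition of transfer factors*, Math. Ann. 278 (1987), §3.
* [Serre1979] J.-P. Serre, *Local Fields*, GTM 67 (1979), Ch. V §3 Cor. 3.
-/

set_option autoImplicit false

noncomputable section

namespace Summit.HodgeConjecture.HodgeConjecture.Cruxes.H413.F0P3cDyRamDiagonalLabelledOddFibreClasses

open Literature.NumberTheory.Automorphic Literature.NumberTheory.Automorphic.HermitianLattice
open Literature.NumberTheory.Automorphic.UnitaryLatticeTree Literature.NumberTheory.Automorphic.UnitaryThreeFourFrame
open Summit.HodgeConjecture.HodgeConjecture.Cruxes.H413.F0P3cDyRamDiagonalTorusDefs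
open Summit.HodgeConjecture.HodgeConjecture.Cruxes.H413.F0P3cDyRamDiagonalOrbitFibreTransport
open Summit.HodgeConjecture.HodgeConjecture.Cruxes.H413.F0P3cDyRamTorusRepresentativesCount
open Summit.HodgeConjecture.HodgeConjecture.Cruxes.H413.F0P3cDyRamDiagonalPairReindex
open Summit.HodgeConjecture.HodgeConjecture.Cruxes.H413.F0P3cDyRamDiagonalOrbitFibreCount
open Summit.HodgeConjecture.HodgeConjecture.Cruxes.H413.F0P3cDyRamDiagonalKappaCountEval (normSign_ite_mul_norm)
open Summit.HodgeConjecture.HodgeConjecture.Cruxes.H413.F0P3cDyRamLabelledOddCountDefs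
open Summit.HodgeConjecture.HodgeConjecture.Cruxes.H413.F0P3cDyRamDiagonalLabelledOddFibreStep
open scoped Valued WithZero Matrix MatrixGroups

variable {K : Type} [Field K] [Valued K ℤᵐ⁰]

/-! ## §1  The class `cls(e,u) = pol(e,u)·N(S̃)` along an `H₀`-coset, `H₀ = 𝒯 ⊓ N⁻¹(N S̃)`; when two classes meet -/

omit [Valued K ℤᵐ⁰] in
/-- helper: an identity in `(K^×)³` is checked coordinatewise in `K`. [cite: Kottwitz1986BaseChangeUnits, §1 pp. 240–241] -/
theorem units_pi_ext {x y : Fin 3 → Kˣ} (h : ∀ i, ((x i : Kˣ) : K) = y i) : x = y := funext fun i => Units.ext (h i)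

/-- **THE CLASS IS CONSTANT ALONG AN `H₀`-COSET**: `cls(e, u·h) = cls(e, u)` for `h ∈ H₀ = 𝒯 ⊓ N⁻¹(N(S̃ ∩ 𝒯))` (`pol(e,u·h) = pol(e,u)·N h`, `N h ∈ N S̃`).
[cite: Kottwitz1986BaseChangeUnits, §1 pp. 240–241] -/
theorem normClass_mul_eq (σ : K →+* K) {M₀ : Submodule 𝒪[K] (Fin 3 → K)} {D₁ : Fin 3 → K} {w : Fin 3 → Kˣ}
    (cvec : (Fin 3 → Bool) → (Fin 3 → Kˣ))
    (sEU : (Fin 3 → Bool) → (Fin 3 → Kˣ) → (Fin 3 → Kˣ)) (hsEU : ∀ e u, sEU e u = cvec e * unitNormMap σ 3 u * w⁻¹)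
    (pol : (Fin 3 → Bool) → (Fin 3 → Kˣ) → (Fin 3 → K)) (hpol : ∀ e u j, pol e u j = D₁ j * ((sEU e u j : Kˣ) : K))
    (cls : (Fin 3 → Bool) → (Fin 3 → Kˣ) → Set (Fin 3 → K))
    (hcls : ∀ e u, cls e u = {D' | ∃ n ∈ (unitStabilizer M₀).map (unitNormMap σ 3), ∀ j, D' j = pol e u j * ((n j : Kˣ) : K)})
    (e : Fin 3 → Bool) (u : Fin 3 → Kˣ) {h : Fin 3 → Kˣ} (hh : h ∈ unitTorus K 3 ⊓ ((unitStabilizer M₀).map (unitNormMap σ 3)).comap (unitNormMap σ 3)) :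
    cls e (u * h) = cls e u := by
  have hNh : unitNormMap σ 3 h ∈ (unitStabilizer M₀).map (unitNormMap σ 3) := by
    have := (Subgroup.mem_inf.1 hh).2; rwa [Subgroup.mem_comap] at this
  ext D'
  simp only [hcls, Set.mem_setOf_eq, pol_mul σ cvec sEU hsEU pol hpol]
  constructor
  · rintro ⟨n, hn, hD'⟩
    refine ⟨unitNormMap σ 3 h * n, Subgroup.mul_mem _ hNh hn, fun j => ?_⟩
    rw [hD' j, Pi.mul_apply, Units.val_mul, mul_assoc]
  · rintro ⟨n, hn, hD'⟩
    refine ⟨(unitNormMap σ 3 h)⁻¹ * n, Subgroup.mul_mem _ (Subgroup.inv_mem _ hNh) hn, fun j => ?_⟩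
    rw [hD' j, Pi.mul_apply, Pi.inv_apply, Units.val_mul, Units.val_inv_eq_inv_val]
    field_simp

/-- **WHEN TWO CLASSES MEET**: if `pol(e',u') ∈ cls(e,u)` (`u, u' ∈ 𝒯`) then `e' = e` (uniqueness of the sign vector of a fixed unit modulo norms, ★ M) and `u⁻¹u' ∈ H₀`.
[cite: Serre1979, Ch. V §3 Cor. 3] [cite: Kottwitz1986BaseChangeUnits, §1 pp. 240–241] -/
theorem eq_and_mem_of_pol_mem_normClass {σ : K →+* K} (hvσ : ∀ a, Valued.v (σ a) = Valued.v a)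
    {c : K} (hσc : σ c = c) (hcv : Valued.v c = 1) (hc : ¬ ∃ z : K, z * σ z = c)
    (hdich : ∀ x : K, σ x = x → x ≠ 0 → (∃ z : K, z * σ z = x) ∨ ∃ z : K, z * σ z = c * x)
    (cU : Kˣ) (hcU : (cU : K) = c) {M₀ : Submodule 𝒪[K] (Fin 3 → K)} {D₁ : Fin 3 → K} (hD₁ : ∀ i, σ (D₁ i) = D₁ i ∧ D₁ i ≠ 0) {w : Fin 3 → Kˣ}
    (cvec : (Fin 3 → Bool) → (Fin 3 → Kˣ)) (hcvec : ∀ e, cvec e = fun j => if e j then cU else 1)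
    (sEU : (Fin 3 → Bool) → (Fin 3 → Kˣ) → (Fin 3 → Kˣ)) (hsEU : ∀ e u, sEU e u = cvec e * unitNormMap σ 3 u * w⁻¹)
    (pol : (Fin 3 → Bool) → (Fin 3 → Kˣ) → (Fin 3 → K)) (hpol : ∀ e u j, pol e u j = D₁ j * ((sEU e u j : Kˣ) : K))
    (cls : (Fin 3 → Bool) → (Fin 3 → Kˣ) → Set (Fin 3 → K))
    (hcls : ∀ e u, cls e u = {D' | ∃ n ∈ (unitStabilizer M₀).map (unitNormMap σ 3), ∀ j, D' j = pol e u j * ((n j : Kˣ) : K)})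
    {e e' : Fin 3 → Bool} {u u' : Fin 3 → Kˣ} (hu : u ∈ unitTorus K 3) (hu' : u' ∈ unitTorus K 3) (hmem : pol e' u' ∈ cls e u) :
    e' = e ∧ u⁻¹ * u' ∈ unitTorus K 3 ⊓ ((unitStabilizer M₀).map (unitNormMap σ 3)).comap (unitNormMap σ 3) := by
  rw [hcls] at hmem
  obtain ⟨n, hn, hD'⟩ := hmem
  have hcvecU : ∀ e : Fin 3 → Bool, cvec e ∈ fixedUnitTorus σ 3 := by
    intro e
    rw [mem_fixedUnitTorus_iff, hcvec]
    refine ⟨fun i => ?_, fun i => ?_⟩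
    · by_cases h : e i <;> simp [h, hcU, hcv]
    · by_cases h : e i <;> simp [h, hcU, hσc]
  -- `c^{e'}·N(u') = c^{e}·N(u)·n` in `(K^×)³`
  have hvec : cvec e' * unitNormMap σ 3 u' = cvec e * unitNormMap σ 3 u * n := by
    refine units_pi_ext fun j => ?_
    have := hD' j
    simp only [hpol, hsEU, Pi.mul_apply, Pi.inv_apply, Units.val_mul, Units.val_inv_eq_inv_val] at this ⊢
    have hw0 : ((w j : Kˣ) : K) ≠ 0 := Units.ne_zero _
    have hD0 : D₁ j ≠ 0 := (hD₁ j).2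
    field_simp at this
    linear_combination this
  have hnNT : n ∈ (unitTorus K 3).map (unitNormMap σ 3) := by
    obtain ⟨t, ht, rfl⟩ := hn
    exact Subgroup.mem_map_of_mem _ (Subgroup.mem_inf.1 ht).2
  have hx : cvec e' * (cvec e)⁻¹ = unitNormMap σ 3 (u * u'⁻¹) * n := by
    rw [map_mul, map_inv]
    refine units_pi_ext fun j => ?_
    have := congrArg (fun f : Fin 3 → Kˣ => ((f j : Kˣ) : K)) hvec
    simp only [Pi.mul_apply, Pi.inv_apply, Units.val_mul, Units.val_inv_eq_inv_val] at this ⊢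
    have h1 : (((unitNormMap σ 3 u') j : Kˣ) : K) ≠ 0 := Units.ne_zero _
    have h2 : ((cvec e j : Kˣ) : K) ≠ 0 := Units.ne_zero _
    field_simp
    linear_combination this
  obtain ⟨e₀, -, huniq⟩ := existsUnique_signVector_mem_map_unitNormMap hvσ hσc hcv hc hdich cU hcU (cvec e') (hcvecU e')
  have hce : ∀ e : Fin 3 → Bool, cvec e = fun j => if e j then cU else 1 := hcvec
  have he' : e' = e₀ := huniq e' (by beta_reduce; rw [← hce e', mul_inv_cancel]; exact Subgroup.one_mem _)
  have he : e = e₀ := huniq e (by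
    beta_reduce
    rw [← hce e, hx]
    exact Subgroup.mul_mem _ (Subgroup.mem_map_of_mem _ ((unitTorus K 3).mul_mem hu ((unitTorus K 3).inv_mem hu'))) hnNT)
  have hee : e' = e := he'.trans he.symm
  refine ⟨hee, ?_⟩
  have hn' : unitNormMap σ 3 (u⁻¹ * u') = n := by
    rw [map_mul, map_inv]
    have := hvec
    rw [hee] at this
    have h3 : unitNormMap σ 3 u' = unitNormMap σ 3 u * n := mul_left_cancel (by rw [← mul_assoc]; exact this)
    rw [h3, inv_mul_cancel_left]
  refine Subgroup.mem_inf.2 ⟨(unitTorus K 3).mul_mem ((unitTorus K 3).inv_mem hu) hu', ?_⟩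
  rw [Subgroup.mem_comap, hn']
  exact hn

/-! ## §2  The signed label of a class; every class has a representative `(e, u)`; classes of good `(e, u)` are polarisation classes -/

/-- **ON THE CLASS OF A GOOD `(e, u)` THE LABEL HOLDS AND THE ODD SIGN OF SLOT `i` IS `(−1)^{e_i}`**: every `D' ∈ cls(e,u)` is `D' = c^{e}·N((ϖu^{a₀}·u·t))` coordinatewise
(`t ∈ S̃ ∩ 𝒯`), so `ω(D'_i) = ω(c^{e_i})` (norms are `ω`-trivial, ★ `normSign_ite_mul_norm`) and `Λ(M₀, D') = Λ(M₀, pol(e,u))` (torus equivariance).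
[cite: LanglandsShelstad1987, §3] [cite: Rogawski1990, §4.10 p. 58] [cite: Kottwitz1986BaseChangeUnits, §1 pp. 240–241] -/
theorem label_and_normSign_of_mem_normClass (σ : K →+* K) (ϖu : Kˣ) {c : K} (hcv : Valued.v c = 1) (hc : ¬ ∃ z : K, z * σ z = c)
    (cU : Kˣ) (hcU : (cU : K) = c) {M₀ : Submodule 𝒪[K] (Fin 3 → K)} {D₁ : Fin 3 → K} {a₀ : Fin 3 → ℤ} {w : Fin 3 → Kˣ}
    (hD₁w : ∀ i, D₁ i = ((unitNormMap σ 3 (fun j => ϖu ^ a₀ j) i : Kˣ) : K) * ((w i : Kˣ) : K))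
    (Λ : Submodule 𝒪[K] (Fin 3 → K) → (Fin 3 → K) → Prop) (hΛ : IsTorusEquivariantLabel σ Λ)
    (cvec : (Fin 3 → Bool) → (Fin 3 → Kˣ)) (hcvec : ∀ e, cvec e = fun j => if e j then cU else 1)
    (sEU : (Fin 3 → Bool) → (Fin 3 → Kˣ) → (Fin 3 → Kˣ)) (hsEU : ∀ e u, sEU e u = cvec e * unitNormMap σ 3 u * w⁻¹)
    (pol : (Fin 3 → Bool) → (Fin 3 → Kˣ) → (Fin 3 → K)) (hpol : ∀ e u j, pol e u j = D₁ j * ((sEU e u j : Kˣ) : K))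
    (cls : (Fin 3 → Bool) → (Fin 3 → Kˣ) → Set (Fin 3 → K))
    (hcls : ∀ e u, cls e u = {D' | ∃ n ∈ (unitStabilizer M₀).map (unitNormMap σ 3), ∀ j, D' j = pol e u j * ((n j : Kˣ) : K)})
    (i : Fin 3) {e : Fin 3 → Bool} {u : Fin 3 → Kˣ} (hL : Λ M₀ (pol e u)) {D' : Fin 3 → K} (hD' : D' ∈ cls e u) :
    Λ M₀ D' ∧ normSign σ (D' i) = (if e i then (-1 : ℤ) else 1) := by
  rw [hcls] at hD'
  obtain ⟨n, hn, hD'n⟩ := hD'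
  obtain ⟨t, ht, rfl⟩ := hn
  have hc0 : c ≠ 0 := fun h => by simp [h] at hcv
  have hne : (if e i then c else (1 : K)) ≠ 0 := by by_cases h : e i <;> simp [h, hc0]
  have hfun : D' = fun j => pol e u j * ((unitNormMap σ 3 t j : Kˣ) : K) := funext hD'n
  refine ⟨by rw [hfun, label_mul_unitNormMap_iff Λ hΛ _ ht]; exact hL, ?_⟩
  rw [hD'n i, pol_apply_eq σ ϖu cU hcU hD₁w cvec hcvec sEU hsEU pol hpol e u i, unitNormMap_apply, mul_assoc,
    show ((((fun k => ϖu ^ a₀ k) * u) i : Kˣ) : K) * σ ((((fun k => ϖu ^ a₀ k) * u) i : Kˣ) : K) * ((t i : K) * σ (t i : K))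
      = ((((fun k => ϖu ^ a₀ k) * u) i : Kˣ) : K) * (t i : K) * σ (((((fun k => ϖu ^ a₀ k) * u) i : Kˣ) : K) * (t i : K)) by rw [map_mul]; ring]
  have hZ : ((((fun k => ϖu ^ a₀ k) * u) i : Kˣ) : K) * (t i : K) ≠ 0 := mul_ne_zero (Units.ne_zero _) (Units.ne_zero _)
  exact normSign_ite_mul_norm σ hc (e i) _ (mul_ne_zero hne (mul_ne_zero hZ ((map_ne_zero σ).2 hZ)))

/-- **EVERY POLARISATION CLASS IS THE CLASS OF SOME `(e, u)` WITH `s(e,u) ∈ S_F`, REPRESENTED BY `pol(e,u)`** (the class of `D = D₁·s_F`: write `w·s_F = c^{e}·N(u)` by ★ M).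
[cite: Serre1979, Ch. V §3 Cor. 3] [cite: Kottwitz1986BaseChangeUnits, §1 pp. 240–241] -/
theorem exists_rep_of_mem_polarisationNormClasses {σ : K →+* K} (hvσ : ∀ a, Valued.v (σ a) = Valued.v a) {ϖ : K}
    {c : K} (hσc : σ c = c) (hcv : Valued.v c = 1) (hc : ¬ ∃ z : K, z * σ z = c)
    (hdich : ∀ x : K, σ x = x → x ≠ 0 → (∃ z : K, z * σ z = x) ∨ ∃ z : K, z * σ z = c * x)
    (cU : Kˣ) (hcU : (cU : K) = c) {M₀ : Submodule 𝒪[K] (Fin 3 → K)} (tv : ℕ)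
    (hcoset : ∀ D₁ : Fin 3 → K, (∀ i, σ (D₁ i) = D₁ i ∧ D₁ i ≠ 0) → IsVertexLattice σ ϖ (Matrix.diagonal D₁) tv M₀ →
      ∀ D : Fin 3 → K, (∀ i, σ (D i) = D i ∧ D i ≠ 0) →
        (IsVertexLattice σ ϖ (Matrix.diagonal D) tv M₀ ↔ ∃ u ∈ fixedUnitStabilizer σ M₀, ∀ i, D i = D₁ i * (u i : Kˣ)))
    {D₁ : Fin 3 → K} (hD₁ : ∀ i, σ (D₁ i) = D₁ i ∧ D₁ i ≠ 0) (hV₁ : IsVertexLattice σ ϖ (Matrix.diagonal D₁) tv M₀)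
    {w : Fin 3 → Kˣ} (hwU : w ∈ fixedUnitTorus σ 3)
    (cvec : (Fin 3 → Bool) → (Fin 3 → Kˣ)) (hcvec : ∀ e, cvec e = fun j => if e j then cU else 1)
    (sEU : (Fin 3 → Bool) → (Fin 3 → Kˣ) → (Fin 3 → Kˣ)) (hsEU : ∀ e u, sEU e u = cvec e * unitNormMap σ 3 u * w⁻¹)
    (pol : (Fin 3 → Bool) → (Fin 3 → Kˣ) → (Fin 3 → K)) (hpol : ∀ e u j, pol e u j = D₁ j * ((sEU e u j : Kˣ) : K))
    (cls : (Fin 3 → Bool) → (Fin 3 → Kˣ) → Set (Fin 3 → K))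
    (hcls : ∀ e u, cls e u = {D' | ∃ n ∈ (unitStabilizer M₀).map (unitNormMap σ 3), ∀ j, D' j = pol e u j * ((n j : Kˣ) : K)})
    {C : Set (Fin 3 → K)} (hC : C ∈ polarisationNormClasses σ ϖ tv M₀) :
    ∃ (e : Fin 3 → Bool) (u : Fin 3 → Kˣ), u ∈ unitTorus K 3 ∧ sEU e u ∈ fixedUnitStabilizer σ M₀ ∧ C = cls e u ∧ pol e u ∈ C := by
  rw [mem_polarisationNormClasses_iff] at hC
  obtain ⟨D, ⟨hDfix, hDV⟩, rfl⟩ := hC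
  obtain ⟨sF, hsF, hDs⟩ := (hcoset D₁ hD₁ hV₁ D hDfix).1 hDV
  have hsFU : w * sF ∈ fixedUnitTorus σ 3 := (fixedUnitTorus σ 3).mul_mem hwU (by
    have h := (mem_fixedUnitStabilizer_iff σ M₀ sF).1 hsF
    exact (mem_fixedUnitTorus_iff σ sF).2 ⟨h.2.1, h.2.2⟩)
  obtain ⟨e, he, -⟩ := existsUnique_signVector_mem_map_unitNormMap hvσ hσc hcv hc hdich cU hcU (w * sF) hsFU
  obtain ⟨u, hu, hNu⟩ := he
  have hs : sEU e u = sF := by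
    rw [hsEU, ← hNu.symm, hcvec]
    refine units_pi_ext fun j => ?_
    simp only [Pi.mul_apply, Pi.inv_apply, Units.val_mul, Units.val_inv_eq_inv_val]
    field_simp
  have hpolD : pol e u = D := by
    funext j; rw [hpol, hs, hDs j]
  refine ⟨e, u, hu, by rw [hs]; exact hsF, ?_, ?_⟩
  · ext D'
    rw [hcls]
    simp only [Set.mem_setOf_eq, hpolD]
  · exact ⟨1, Subgroup.one_mem _, fun j => by rw [hpolD]; simp⟩

/-- **THE CLASS OF A GOOD `(e, u)` IS A POLARISATION CLASS** (`pol(e,u) = D₁·s(e,u)` is a `σ`-fixed non-degenerate type-`tv` polarisation by `hcoset`).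
[cite: Kottwitz1986BaseChangeUnits, §1 pp. 240–241] [cite: Rogawski1990, §4.9 Prop. 4.9.1 (a) p. 55] -/
theorem normClass_mem_polarisationNormClasses (σ : K →+* K) {ϖ : K} {M₀ : Submodule 𝒪[K] (Fin 3 → K)} (tv : ℕ)
    (hcoset : ∀ D₁ : Fin 3 → K, (∀ i, σ (D₁ i) = D₁ i ∧ D₁ i ≠ 0) → IsVertexLattice σ ϖ (Matrix.diagonal D₁) tv M₀ →
      ∀ D : Fin 3 → K, (∀ i, σ (D i) = D i ∧ D i ≠ 0) →
        (IsVertexLattice σ ϖ (Matrix.diagonal D) tv M₀ ↔ ∃ u ∈ fixedUnitStabilizer σ M₀, ∀ i, D i = D₁ i * (u i : Kˣ)))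
    {D₁ : Fin 3 → K} (hD₁ : ∀ i, σ (D₁ i) = D₁ i ∧ D₁ i ≠ 0) (hV₁ : IsVertexLattice σ ϖ (Matrix.diagonal D₁) tv M₀)
    (sEU : (Fin 3 → Bool) → (Fin 3 → Kˣ) → (Fin 3 → Kˣ))
    (pol : (Fin 3 → Bool) → (Fin 3 → Kˣ) → (Fin 3 → K)) (hpol : ∀ e u j, pol e u j = D₁ j * ((sEU e u j : Kˣ) : K))
    (cls : (Fin 3 → Bool) → (Fin 3 → Kˣ) → Set (Fin 3 → K))
    (hcls : ∀ e u, cls e u = {D' | ∃ n ∈ (unitStabilizer M₀).map (unitNormMap σ 3), ∀ j, D' j = pol e u j * ((n j : Kˣ) : K)})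
    (e : Fin 3 → Bool) {u : Fin 3 → Kˣ} (hs : sEU e u ∈ fixedUnitStabilizer σ M₀) : cls e u ∈ polarisationNormClasses σ ϖ tv M₀ := by
  rw [mem_polarisationNormClasses_iff]
  have hDfix : ∀ j, σ (pol e u j) = pol e u j ∧ pol e u j ≠ 0 := fun j => by
    have h := (mem_fixedUnitStabilizer_iff σ M₀ (sEU e u)).1 hs
    rw [hpol]
    exact ⟨by rw [map_mul, (hD₁ j).1, h.2.2 j], mul_ne_zero (hD₁ j).2 (Units.ne_zero _)⟩
  refine ⟨pol e u, ⟨hDfix, (hcoset D₁ hD₁ hV₁ _ hDfix).2 ⟨sEU e u, hs, fun j => hpol e u j⟩⟩, ?_⟩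
  rw [hcls]

/-! ## §3  The index identity `[H₀ : S̃]·[𝒰 : N S̃] = 8·[𝒯 : S̃]` -/

/-- **THE INDEX IDENTITY OF THE LABELLED COUNT**: with `S̃ = S̃(M₀) ∩ 𝒯`, `N S̃` its norms, `H₀ = 𝒯 ⊓ N⁻¹(N S̃)`:
`[H₀ : S̃] · [𝒰 : N S̃] = 8 · [𝒯 : S̃]` (as `relIndex`es, `[H₀ : S̃]` written `(latticeStabilizer M₀).relIndex H₀`) — from `[𝒯 : H₀] = [N𝒯 : N S̃]` (`relIndex_comap`) and
★ `[𝒰 : N𝒯] = 8` (the eight sign vectors `c^{e}` represent `𝒰 ∕ N𝒯`, ★ M). [cite: Serre1979, Ch. V §3 Cor. 3] [cite: Kottwitz1986BaseChangeUnits, §1 pp. 240–241] -/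
theorem relIndex_mul_relIndex_map_unitStabilizer_eq {σ : K →+* K} (hσ : ∀ x, σ (σ x) = x) (hvσ : ∀ a, Valued.v (σ a) = Valued.v a)
    {c : K} (hσc : σ c = c) (hcv : Valued.v c = 1) (hc : ¬ ∃ z : K, z * σ z = c)
    (hdich : ∀ x : K, σ x = x → x ≠ 0 → (∃ z : K, z * σ z = x) ∨ ∃ z : K, z * σ z = c * x)
    (cU : Kˣ) (hcU : (cU : K) = c) (M₀ : Submodule 𝒪[K] (Fin 3 → K)) :
    (latticeStabilizer M₀).relIndex (unitTorus K 3 ⊓ ((unitStabilizer M₀).map (unitNormMap σ 3)).comap (unitNormMap σ 3)) *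
        ((unitStabilizer M₀).map (unitNormMap σ 3)).relIndex (fixedUnitTorus σ 3) = 8 * (unitStabilizer M₀).relIndex (unitTorus K 3) := by
  classical
  set NS : Subgroup (Fin 3 → Kˣ) := (unitStabilizer M₀).map (unitNormMap σ 3) with hNSdef
  set H₀ : Subgroup (Fin 3 → Kˣ) := unitTorus K 3 ⊓ NS.comap (unitNormMap σ 3) with hH₀
  set cvec : (Fin 3 → Bool) → (Fin 3 → Kˣ) := fun e i => if e i then cU else 1 with hcvec
  have hcvecU : ∀ e, cvec e ∈ fixedUnitTorus σ 3 := by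
    intro e
    rw [mem_fixedUnitTorus_iff, hcvec]
    refine ⟨fun i => ?_, fun i => ?_⟩
    · by_cases h : e i <;> simp [h, hcU, hcv]
    · by_cases h : e i <;> simp [h, hcU, hσc]
  have hNT : (unitTorus K 3).map (unitNormMap σ 3) ≤ fixedUnitTorus σ 3 := map_unitNormMap_unitTorus_le hσ hvσ
  have hrep : ∀ x ∈ fixedUnitTorus σ 3, ∃! e : Fin 3 → Bool, x * (cvec e)⁻¹ ∈ (unitTorus K 3).map (unitNormMap σ 3) :=
    fun x hx => existsUnique_signVector_mem_map_unitNormMap hvσ hσc hcv hc hdich cU hcU x hx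
  have h8 : ((unitTorus K 3).map (unitNormMap σ 3)).relIndex (fixedUnitTorus σ 3) = 8 := by
    rw [← card_filter_mem_coset_eq_relIndex ((unitTorus K 3).map (unitNormMap σ 3)) (fixedUnitTorus σ 3) (fixedUnitTorus σ 3) hNT le_rfl
      cvec hcvecU hrep 1 (Subgroup.one_mem _)]
    rw [Finset.filter_true_of_mem (fun e _ => by rw [inv_one, one_mul]; exact hcvecU e)]
    simp
  have hStH₀ : unitStabilizer M₀ ≤ H₀ := by
    intro t ht
    refine Subgroup.mem_inf.2 ⟨(Subgroup.mem_inf.1 ht).2, ?_⟩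
    rw [Subgroup.mem_comap]
    exact Subgroup.mem_map_of_mem _ ht
  have hNSNT : NS ≤ (unitTorus K 3).map (unitNormMap σ 3) := Subgroup.map_mono inf_le_right
  have hH₀T : H₀ ≤ unitTorus K 3 := inf_le_left
  have hidx1 : (unitStabilizer M₀).relIndex H₀ * H₀.relIndex (unitTorus K 3) = (unitStabilizer M₀).relIndex (unitTorus K 3) :=
    Subgroup.relIndex_mul_relIndex _ _ _ hStH₀ hH₀T
  have hidx2 : NS.relIndex ((unitTorus K 3).map (unitNormMap σ 3)) * ((unitTorus K 3).map (unitNormMap σ 3)).relIndex (fixedUnitTorus σ 3) =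
      NS.relIndex (fixedUnitTorus σ 3) := Subgroup.relIndex_mul_relIndex _ _ _ hNSNT hNT
  have hidx3 : H₀.relIndex (unitTorus K 3) = NS.relIndex ((unitTorus K 3).map (unitNormMap σ 3)) := by
    rw [hH₀, inf_comm, Subgroup.inf_relIndex_right, Subgroup.relIndex_comap]
  have hSH : (latticeStabilizer M₀).relIndex H₀ = (unitStabilizer M₀).relIndex H₀ := by
    rw [show unitStabilizer M₀ = latticeStabilizer M₀ ⊓ unitTorus K 3 from rfl, ← Subgroup.inf_relIndex_right (latticeStabilizer M₀ ⊓ unitTorus K 3) H₀,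
      ← Subgroup.inf_relIndex_right (latticeStabilizer M₀) H₀]
    congr 1
    rw [inf_assoc, inf_eq_right.2 hH₀T]
  rw [hSH, ← hidx2, h8, ← hidx3, ← hidx1]
  ring

end Summit.HodgeConjecture.HodgeConjecture.Cruxes.H413.F0P3cDyRamDiagonalLabelledOddFibreClasses

end
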